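import Summits.QuantumFields.BalabanUV.T4Continuum.Support.NE7EffectiveFormLowerBound
import Summits.QuantumFields.BalabanUV.T4Continuum.Support.NE3ClassRadiusFamily
import HarnessLib

/-!
# NE7EffectiveFormLowerBoundClass — (G′) AT d = 4 WITH THE SLICE POINCARÉ HYPOTHESIS DISCHARGED ON THE CLASS: every remaining hypothesis is a k-FREE NUMERIC LINE in
# `(ε; τ, ε_c)` (lineage `b2b-balaban-t4-ne7-p1`, gen 119, file H16 = ROAD-G119 §5 S5′ completed)

Cell `pub-balaban`, rung (B)+1 sub-cell t4, CRUX PROVER NE7 #1 (OWNER of row NE7), generation 119.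
WHY.  ✓ H15 `NE7EffectiveFormLowerBound.effectiveForm_lower_bound` is (G′) — the effective-form lower bound of the Hessian of the constrained minimal action at a minimiser, j- and
N-uniform at `d = 4` — with ONE structural hypothesis left displayed, the slice Poincaré inequality `SlicePoincare L (j+1) U♯ (frameFreeBlockLandauW …) C_P` of rows NE3∕Y.  Row NE3's
K-road proved it ON THE WHOLE CLASS with ONE k-free constant: ✓ `NE3ClassRadiusFamily.classSlicePoincare_of_lines'` (`W ∈ sfClass d L N ε (j+1) ⟹ SlicePoincare … (CPLine d L (card n) ε_c τ)`
under k-free numeric lines in `(ε; τ, ε_c)`), and a minimiser lies in the class.  THIS FILE substitutes it: **`effectiveForm_lower_bound_class`** — (G′) whose hypotheses are ALL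
numeric smallness lines (H11's and H15's ε-lines, the four K-road lines in `(τ, ε_c)`, `ε ≤ τ`, and the two `(ε, C_P)`-lines with `C_P = CPLine 4 L (card n) ε_c τ`).
WHAT ([folklore]; 0 def, 0 sorry; d = 4): **`effectiveForm_lower_bound_class`**.
HONEST FRAMING (page 1): (G′) is an estimate about OUR lattice objects (constrained minimal action `minAct`, block-averaging tower, class `sfClass`, the all-data frame «∃ δV, ∀ V₀ δV-small»
of the lineage); it is row NE7's binder target in that frame, NOT Bałaban's NE7 as printed and NOT a spine node by itself (the spine's NE7 consumes it through the NE7b∕NE9 records);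
nothing of Bałaban's asserted; spine 0∕9; finite T⁴ rung (B)+1 — NOT continuum YM on ℝ⁴, NOT infinite volume, NOT mass gap, NOT BetaPertH, NOT Clay.
-/

set_option autoImplicit false

open scoped BigOperators Matrix Matrix.Norms.L2Operator Topology
open NormedSpace Finset Set Filter Metric

namespace Summit.QuantumFields.BalabanUV.T4Continuum.NE7EffectiveFormLowerBoundClass

open Literature.MathematicalPhysics.QuantumFieldTheory.Balaban1983to89
open B7Prop1Explicit B7Prop2Explicit MatrixLog UnitaryModel
open T4AveragingDeficitWall (IsUnitaryCfg IsSkewDir SmallField Ad curl curlAt curlSq dirSq dirL1 fineAction)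
open T4AveragingDeficitWallBoundary (IsPeriodicCfg periodBox)
open AveragingDeficitTorusChart (TDir chart chartDir resDir extDir)
open AveragingDeficitTwoLevelPrep (twoLevelSmall skewSub skewPR)
open AveragingDeficitMultiLevelPrep (cavgIter tower levelQ levelQ' LevelSmall tower_ne_zero)
open MatrixNorms (nhsNormSq)
open MinimalActionLevels (perWin stepWt)
open MinimalActionSandwich (IsMinimiser minAct)
open MinimalActionRate (sfClass)
open NE7RadIterUniform (radD)
open NE7StraightTowerCurlEnergy (eC mC)
open NE3QbarIterCovLiftPrep (cruxC)
open NE3RightInverseSolveLetters (thetaLoc)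
open NE3SlicePoincareShape (SlicePoincare)
open NE3FrameFreeSliceW (frameFreeBlockLandauW)
open NE7SliceRepHessianFloor (liftMassC liftCurlC)
open NE3HatInvCurlLetters (curl1C)
open BlockAverageVaryHolo (nbRad)
open NE3CovariantLineSumsError (Csup)
open NE3CovariantLineSumsL2 (C2sq)
open NE3CovariantLineSumsL2Tower (rho)
open ShellMeasureAverageProp4General (C1cov)
open NE3SlicePoincareBudgetLine (ShLine SmallYLine CPLine)
open NE3ClassRadiusFamily (classSlicePoincare_of_lines' CPLine_nonneg)
open NE7StrippedConstraintMap (strippedConstraint)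
open NE7EffectiveFormLowerBound (effectiveForm_lower_bound)

noncomputable section

variable {n : Type} [Fintype n] [DecidableEq n]

/-- **(G′) AT d = 4, ALL HYPOTHESES NUMERIC** (see the module docstring): `C_P := CPLine 4 L (card n) ε_c τ`, `C_Λ(ε) := 2·curl1C·ε·(128·C₁L²·4(4L+1)⁴·L²)`; for every small `ε`
(the displayed lines), every `N ≥ 1` and every `j`, there is `δV > 0` such that for every `δV`-small datum `V₀`, every minimiser `U♯`, every `θ > 0` and every coarse direction `v`,
`(1 − C_Λa)·w·Σ_P nhs(curl_{V₀} ṽ) ≤ A·D²(minAct∘chart_{V₀})(0)[v,v] + w·(2A·C_Λ·ρ + (1 − C_Λa)·2K·ρ)·dirSq ṽ`. [folklore] -/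
theorem effectiveForm_lower_bound_class [Nonempty n] {L : ℕ} [NeZero L] (hL : 2 ≤ L) :
    ∃ ε₀ : ℝ, 0 < ε₀ ∧ ∀ ε : ℝ, 0 < ε → ε ≤ ε₀ →
      4 * (2 * ε) * radD 4 L * (((L : ℝ) ^ 2)⁻¹) ^ 2 ≤ 1 → twoLevelSmall 4 L * (2 * (2 * ε) * ((L : ℝ) ^ 2)⁻¹) ≤ 1 →
      8 * (L : ℝ) * mC 4 L (Fintype.card n) * ε * ((L : ℝ) ^ 2)⁻¹ ≤ 1 → ε ≤ 1 → cruxC 4 L * ε < 1 → thetaLoc 4 L * ε ≤ 1 / 2 → 43584 * ε ≤ 1 / 2 →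
      C0 4 * (2 * (3 * ε)) ≤ 1 / 3 → 4 * (2 * (3 * ε)) ≤ c2' 4 L →
      Real.exp (4 * (800 * (((4 : ℕ) : ℝ) + 1) ^ 2 * (((4 : ℕ) : ℝ) + 4)) * (3 * ε)) ≤ 3 / 2 →
      4 * ε * radD 4 L * (((L : ℝ) ^ 2)⁻¹) ^ 2 ≤ 1 →
      (16 * ((4 : ℝ) + 1) * ((4 : ℝ) + 4) * (L : ℝ) ^ 2 * Csup 4 L * (4 * (2 * (nbRad 4 L : ℝ) + 1) ^ 4)) * (8 / 3 * ε * ((L : ℝ) ^ 2)⁻¹) ≤ ((L : ℝ) / (L : ℝ) ^ 4) / 2 →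
      -- the K-road lines of row NE3's class slice Poincaré inequality, in the auxiliary parameters `τ, ε_c`
      ∀ τ εc : ℝ, ε ≤ τ → 0 < εc →
      16 * (14464 * (((4 : ℕ) : ℝ) + 1) ^ 2 * (((4 : ℕ) : ℝ) + 4) ^ 2) * ε ≤ 3 → 2 * twoLevelSmall 4 L * ε ≤ (L : ℝ) ^ 2 →
      ShLine 4 L (Fintype.card n) εc τ ≤ 1 / 2 → SmallYLine 4 L (Fintype.card n) εc τ ≤ 1 / 2 →
      68 / 3 * ((((4 : ℕ) : ℝ) + 1) * (((4 : ℕ) : ℝ) + 4)) * C2sq 4 L * τ ≤ rho 4 L / 2 →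
      8 * ((4 : ℕ) : ℝ) * ((((4 : ℕ) : ℝ) - 1) * τ) ^ 2
        + 2 * ((Fintype.card n : ℝ) * ((4 * ((4 : ℕ) : ℝ) ^ 2 + 272 * ((4 : ℕ) : ℝ) * ((((4 : ℕ) : ℝ) + 1) * (((4 : ℕ) : ℝ) + 4))) * τ) ^ 2) ≤ 1 / 2 →
      -- the two `(ε, C_P)`-lines
      28 * (Fintype.card (T4AveragingDeficitWall.Plane 4) : ℝ) * ε * (4 * CPLine 4 L (Fintype.card n) εc τ * Fintype.card n) ≤ 1 →
      (2 * curl1C 4 L * ε * (128 * (C1cov 4 * (L : ℝ) ^ 2 * (4 * (4 * (L : ℝ) + 1) ^ 4)) * (L : ℝ) ^ 2)) * (2 * (4 * CPLine 4 L (Fintype.card n) εc τ * Fintype.card n)) ≤ 1 →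
      ∀ (N : ℕ) [NeZero N], 1 ≤ N → ∀ j : ℕ,
      ∃ δV : ℝ, 0 < δV ∧
        ∀ V₀ ∈ {V : Site 4 → Fin 4 → (Matrix n n ℂ)ˣ | IsUnitaryCfg V ∧ IsPeriodicCfg V (N : ℤ) ∧ SmallField V δV},
        ∀ Us : Site 4 → Fin 4 → (Matrix n n ℂ)ˣ, IsMinimiser 4 (sfClass 4 L N ε) L N (j + 1) V₀ Us → ∀ θ : ℝ, 0 < θ →
        ∀ v : ↥(skewSub 4 n N),
          (1 - (2 * curl1C 4 L * ε * (128 * (C1cov 4 * (L : ℝ) ^ 2 * (4 * (4 * (L : ℝ) + 1) ^ 4)) * (L : ℝ) ^ 2)) * (2 * (4 * CPLine 4 L (Fintype.card n) εc τ * Fintype.card n)))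
              * (((stepWt 4 L)⁻¹) ^ (j + 1) * ∑ P ∈ perWin 4 N, nhsNormSq (curl V₀ (chartDir (ContinuousLinearMap.id ℝ (Matrix n n ℂ)) N (v : TDir 4 n N)) P))
            ≤ ((1 + θ) + 2 * ((1 + θ) * (14 * (Fintype.card (T4AveragingDeficitWall.Plane 4) : ℝ) * ε) + (1 + θ⁻¹) * (36 * eC 4 L (Fintype.card n) ^ 2 * ε ^ 2))
                    * (4 * CPLine 4 L (Fintype.card n) εc τ * Fintype.card n))
                * fderiv ℝ (fderiv ℝ (fun y : ↥(skewSub 4 n N) => minAct 4 (sfClass 4 L N ε) L N (j + 1) (chart (ContinuousLinearMap.id ℝ (Matrix n n ℂ)) N V₀ (y : TDir 4 n N)))) 0 v v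
              + ((stepWt 4 L)⁻¹) ^ (j + 1)
                * (2 * (((1 + θ) + 2 * ((1 + θ) * (14 * (Fintype.card (T4AveragingDeficitWall.Plane 4) : ℝ) * ε) + (1 + θ⁻¹) * (36 * eC 4 L (Fintype.card n) ^ 2 * ε ^ 2))
                        * (4 * CPLine 4 L (Fintype.card n) εc τ * Fintype.card n)))
                      * (2 * curl1C 4 L * ε * (128 * (C1cov 4 * (L : ℝ) ^ 2 * (4 * (4 * (L : ℝ) + 1) ^ 4)) * (L : ℝ) ^ 2)) * (2 * liftMassC 4 L + 4 * CPLine 4 L (Fintype.card n) εc τ * liftCurlC 4 L)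
                    + (1 - (2 * curl1C 4 L * ε * (128 * (C1cov 4 * (L : ℝ) ^ 2 * (4 * (4 * (L : ℝ) + 1) ^ 4)) * (L : ℝ) ^ 2)) * (2 * (4 * CPLine 4 L (Fintype.card n) εc τ * Fintype.card n)))
                      * (2 * ((1 + θ) * (14 * (Fintype.card (T4AveragingDeficitWall.Plane 4) : ℝ) * ε) + (1 + θ⁻¹) * (36 * eC 4 L (Fintype.card n) ^ 2 * ε ^ 2))
                        * (2 * liftMassC 4 L + 4 * CPLine 4 L (Fintype.card n) εc τ * liftCurlC 4 L)))
                * dirSq (chartDir (ContinuousLinearMap.id ℝ (Matrix n n ℂ)) N (v : TDir 4 n N)) (periodBox N) := by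
  obtain ⟨ε₁, hε₁, T⟩ := effectiveForm_lower_bound (n := n) hL
  refine ⟨ε₁, hε₁, fun ε hε hεle hεD2 hεT2 hεM hε1 hcrux hθl2 hEl hα3 hα4 hroom hD hS τ εc hετ hεc hc1 hc2 h1 h2 h3 h4 habs hCΛa N _ hN j => ?_⟩
  obtain ⟨δV, hδV, T1⟩ := T ε hε hεle hεD2 hεT2 hεM hε1 hcrux hθl2 hEl hα3 hα4 hroom hD hS N hN j
  refine ⟨δV, hδV, fun V₀ hV₀ Us hUs θ hθ v => ?_⟩
  have hCP : 0 ≤ CPLine 4 L (Fintype.card n) εc τ := CPLine_nonneg (by norm_num) (Nat.cast_nonneg _) hεc.le (hε.le.trans hετ)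
  have hSP : SlicePoincare L (j + 1) Us (frameFreeBlockLandauW (d := 4) (n := n) L N (j + 1) Us) (CPLine 4 L (Fintype.card n) εc τ) (periodBox (N * L ^ (j + 1))) :=
    classSlicePoincare_of_lines' (d := 4) (by norm_num) hL hN hε hετ hεc hc1 hc2 h1 h2 h3 h4 j Us hUs.mem.1
  exact T1 V₀ hV₀ Us hUs _ hCP hSP habs θ hθ hCΛa v

end

end Summit.QuantumFields.BalabanUV.T4Continuum.NE7EffectiveFormLowerBoundClass
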